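import Mathlib
import Literature.Analysis.InnerProduct.CourantFischerBounds
import Literature.Analysis.InnerProduct.CholeskyResidualEigenvalueBounds

/-!
# Singular values: Courant–Fischer, the Eckart–Young–Mirsky theorem in the spectral norm,
# Weyl's perturbation bound and interlacing — for linear maps and for matrices

Mathlib (`Mathlib.Analysis.InnerProductSpace.SingularValues`) defines the singular values
`T.singularValues : ℕ →₀ ℝ` of a linear map `T : E →ₗ[𝕜] F` between finite-dimensional inner
product spaces (`𝕜 = ℝ` or `ℂ`): `σ₀ ≥ σ₁ ≥ ⋯`, ZERO-INDEXED, `σ_k = √λ_k(T†T)` for `k < dim E`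
and `σ_k = 0` beyond, exactly `rank T` of them positive.  It proves nothing relating them to
NORMS.  This file supplies the classical metric theory, stated with Mathlib's definition (no new
definitions), for linear maps and — through `Matrix.toEuclideanLin` — for rectangular matrices
`A : Matrix m n 𝕜`, whose singular values are `(Matrix.toEuclideanLin A).singularValues`:

* one-sided Rayleigh bounds in the basis `v₀, v₁, …` of right singular vectors (the orthonormal
  eigenvector basis of `T†T`): `‖T x‖ ≤ σ_k ‖x‖` for `x ⊥ v₀, …, v_{k-1}`, `σ_k ‖x‖ ≤ ‖T x‖` for
  `x ⊥ v_{k+1}, …`, `‖T v_k‖ = σ_k`, `‖T x‖ ≤ σ₀ ‖x‖`, `σ₀ = ‖T‖` and `σ_{dim E − 1} ‖x‖ ≤ ‖T x‖`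
  [GolubVanLoan2013, §2.4.2, Cor. 2.4.2–2.4.4 and the proof of Thm. 2.4.8];
* the COURANT–FISCHER THEOREM FOR SINGULAR VALUES in trial-subspace form
  [HornJohnson2013, Thm. 7.3.8; GolubVanLoan2013, Thm. 8.6.1]: a bound `‖T x‖ ≤ c ‖x‖` on a
  subspace of dimension `≥ dim E − k` gives `σ_k ≤ c`; a bound `c ‖x‖ ≤ ‖T x‖` on a subspace of
  dimension `≥ k + 1` gives `c ≤ σ_k`;
* the ECKART–YOUNG–MIRSKY THEOREM IN THE SPECTRAL NORM [GolubVanLoan2013, Thm. 2.4.8 ("the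
  Eckhart–Young theorem"); HornJohnson2013, (7.4.9.2)] (Eckart–Young 1936 treat the Frobenius
  distance — the truncation rule is [EckartYoung1936, p. 216 Eq. (17)] — and Mirsky 1960 every
  unitarily invariant norm, in particular the spectral one): there is `S` of rank `≤ k` with
  `‖T x − S x‖ ≤ σ_k ‖x‖` for all `x` (truncation after `k` singular directions:
  `S = T ∘ P_{span {v₀,…,v_{k-1}}}`), and conversely `‖T x − S x‖ ≤ c ‖x‖` for all `x` with
  `rank S ≤ k` forces `σ_k ≤ c` — the proof of [GolubVanLoan2013, Thm. 2.4.8]: `ker S` meets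
  `span {v₀, …, v_k}` in a non-zero vector; so `σ_k(T) = min_{rank S ≤ k} ‖T − S‖₂`
  (and `σ_k = 0 ↔ rank ≤ k`, [GolubVanLoan2013, Cor. 2.4.6], is Mathlib's
  `LinearMap.singularValues_eq_zero_iff_le_finrank_range`);
* WEYL'S PERTURBATION INEQUALITY `|σ_k(T) − σ_k(T')| ≤ ‖T − T'‖₂` [GolubVanLoan2013,
  Cor. 8.6.2; HornJohnson2013, Cor. 7.3.5 (a)] and INTERLACING UNDER
  COMPRESSION `σ_k(π ∘ T ∘ ι) ≤ ‖π‖ ‖ι‖ σ_k(T)`; for matrices `σ_k(A[r, c]) ≤ σ_k(A)` for every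
  submatrix on injective row/column selections `r`, `c` [HornJohnson2013, Cor. 7.3.6;
  GolubVanLoan2013, Cor. 8.6.3] — both derived here from the two halves of Eckart–Young;
* for matrices: `σ_k(A)² = λ_k(AᴴA)` in Mathlib's antitone enumeration
  `Matrix.IsHermitian.eigenvalues₀` [GolubVanLoan2013, §2.4.2 (2.4.1)–(2.4.2); HornJohnson2013,
  Thm. 7.3.8 (proof)], `σ_k(A) = 0 ↔ rank A ≤ k` (via `rank A = dim range (toEuclideanLin A)`),
  `rank B ≤ k ⇒ σ_k(A) ≤ ‖A − B‖₂`, a rank-`≤ k` matrix `B` with `‖(A − B) x‖ ≤ σ_k(A) ‖x‖` AND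
  `|A i j − B i j| ≤ σ_k(A)` entrywise, and the entrywise/spectral comparisons
  `|M i j| ≤ ‖M e_j‖₂`, `‖M x‖₂ ≤ √(|m| |n|) δ ‖x‖₂` when all `|M i j| ≤ δ`
  [GolubVanLoan2013, (2.3.8), (2.3.11)], hence `|A i j| ≤ σ₀(A) ≤ √(|m| |n|) max |A i j|` and
  `σ_k(A) ≤ √(|m| |n|) δ` whenever SOME matrix of rank `≤ k` is entrywise `δ`-close to `A`.

The last two items are the bridge used by the cross-approximation results of this directory
(`MaximalVolumeErrorBounds`, `PivotedCholeskyErrorBound`, `DiagonallyDominantCrossApproximation`,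
`DiagonallyDominantMaximalVolume`, …, and `TensorNetworks/*`), which state their error bounds
against "any matrix `F` of rank `≤ k` that is entrywise `δ`-close to `A`" precisely so that
`δ = σ_k(A)` (zero-indexed; `σ_{k+1}(A)` in the one-indexed convention of the sources) can be
substituted: `exists_rank_le_norm_toEuclideanLin_sub_le` provides that `F`.

Proofs: everything is reduced to the symmetric operator `T†T` (`‖T x‖² = re ⟪T†T x, x⟫`,
`σ_k² = λ_k(T†T)`) and the trial-subspace Courant–Fischer bounds for
`LinearMap.IsSymmetric.eigenvalues` of `Literature.Analysis.InnerProduct.CourantFischerBounds` /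
`CholeskyResidualEigenvalueBounds`.
NOT formalised here: the singular value DECOMPOSITION as a factorisation `A = U Σ Vᴴ` with left
singular vectors, the Frobenius-norm and general unitarily-invariant-norm versions of the
approximation theorem [EckartYoung1936; Mirsky1960; HornJohnson2013, §7.4.2, Thm. 7.4.9.1,
(7.4.9.2)], Ky Fan norms, and the lower
interlacing inequality `σ_{k+s}(A) ≤ σ_k(Â)` for `s` deleted rows/columns [HornJohnson2013,
Cor. 7.3.6 (7.3.7)] (only `σ_k(Â) ≤ σ_k(A)` is proved).

References: C. Eckart, G. Young, *The approximation of one matrix by another of lower rank*,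
Psychometrika 1 (1936) 211–218; L. Mirsky, *Symmetric gauge functions and unitarily invariant
norms*, Quart. J. Math. Oxford (2) 11 (1960) 50–59, Thm. 2 and §5; G. H. Golub, C. F. Van Loan,
*Matrix Computations*, 4th ed., Johns Hopkins University Press 2013, §2.3.2 (2.3.8), (2.3.11),
§2.4.1–2.4.2 (Cor. 2.4.2, 2.4.3, 2.4.4, 2.4.6, (2.4.1), Thm. 2.4.8), §8.6.2 (Thm. 8.6.1,
Cor. 8.6.2, 8.6.3);
R. A. Horn, C. R. Johnson, *Matrix Analysis*, 2nd ed., Cambridge University Press 2013,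
Cor. 7.3.5, Cor. 7.3.6, Thm. 7.3.8, §7.4.2, §7.4.9 (Thm. 7.4.9.1, (7.4.9.2)).
Mirsky's paper (pp. 50–59) is cited for the history only: no statement here depends on a
locator in it.
AI-produced formalisation (H21 engines group, seat eng-quad-2, 2026-08-22); no facts, no axioms
beyond Mathlib's, no `sorry`.
-/

noncomputable section

open scoped InnerProductSpace
open Module

namespace Literature.LinearAlgebra.Matrix

/-! ## Part I. Linear maps between finite-dimensional inner product spaces -/

section Operator

variable {𝕜 : Type*} [RCLike 𝕜] {E F : Type*} [NormedAddCommGroup E] [InnerProductSpace 𝕜 E]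
  [FiniteDimensional 𝕜 E] [NormedAddCommGroup F] [InnerProductSpace 𝕜 F] [FiniteDimensional 𝕜 F]
  {n : ℕ}

/-- `re ⟪T†T x, x⟫ = ‖T x‖²`: the quadratic form of `T†T` is the squared norm of `T`
(`‖A x‖₂² = xᵀAᵀA x`, the identity behind `g(x) = ½ ‖Ax‖₂² / ‖x‖₂² = ½ xᵀAᵀAx / xᵀx` in the
cited proof, and behind `AᵀA vᵢ = σᵢ² vᵢ`, [GolubVanLoan2013, §2.4.2 (2.4.1)]).
[cite: GolubVanLoan2013, §2.3.3 Thm 2.3.1 (proof)] -/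
theorem re_inner_adjoint_comp_self_apply (T : E →ₗ[𝕜] F) (x : E) :
    RCLike.re ⟪(LinearMap.adjoint T ∘ₗ T) x, x⟫_𝕜 = ‖T x‖ ^ 2 := by
  rw [LinearMap.comp_apply, LinearMap.adjoint_inner_left, inner_self_eq_norm_sq (𝕜 := 𝕜)]

/-- **Upper one-sided Rayleigh bound for singular values.**  If `x` is orthogonal to the right
singular vectors `v₀, …, v_{k-1}` (eigenvectors of `T†T` for its `k` largest eigenvalues, in
Mathlib's antitone enumeration), then `‖T x‖ ≤ σ_k ‖x‖`; for `k ≥ dim E` the hypothesis forces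
`x = 0`.  This is the computation `‖(A − A_k) z‖ ≤ σ_{k+1} ‖z‖` in the proof of the Eckart–Young
theorem. [cite: GolubVanLoan2013, §2.4.2 Thm 2.4.8] -/
theorem norm_apply_le_of_inner_eigenvectorBasis_eq_zero (T : E →ₗ[𝕜] F)
    (hn : finrank 𝕜 E = n) (k : ℕ) {x : E}
    (hx : ∀ i : Fin n, (i : ℕ) < k →
      ⟪T.isSymmetric_adjoint_comp_self.eigenvectorBasis hn i, x⟫_𝕜 = 0) :
    ‖T x‖ ≤ T.singularValues k * ‖x‖ := by
  by_cases hk : k < n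
  · have h := Literature.Analysis.InnerProduct.re_inner_apply_self_le_of_inner_eq_zero
      T.isSymmetric_adjoint_comp_self hn ⟨k, hk⟩ (x := x) (fun i hi => hx i hi)
    rw [re_inner_adjoint_comp_self_apply, ← T.sq_singularValues_of_lt hn hk, ← mul_pow] at h
    exact le_of_sq_le_sq h (mul_nonneg (T.singularValues_nonneg k) (norm_nonneg x))
  · have hx0 : x = 0 := by
      have hsum := Literature.Analysis.InnerProduct.norm_sq_eq_sum_eigenvectorBasis
        T.isSymmetric_adjoint_comp_self hn x
      have hzero : ∑ i : Fin n,
          ‖⟪T.isSymmetric_adjoint_comp_self.eigenvectorBasis hn i, x⟫_𝕜‖ ^ 2 = 0 :=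
        Finset.sum_eq_zero fun i _ => by
          rw [hx i (lt_of_lt_of_le i.isLt (not_lt.mp hk))]
          simp
      rw [hzero, sq_eq_zero_iff, norm_eq_zero] at hsum
      exact hsum
    subst hx0
    simp

/-- **Lower one-sided Rayleigh bound for singular values.**  If `x` is orthogonal to the right
singular vectors `v_{k+1}, v_{k+2}, …`, then `σ_k ‖x‖ ≤ ‖T x‖` (for `k ≥ dim E`, `σ_k = 0`).
This is the computation `‖A z‖² = Σ_{i ≤ k+1} σᵢ² (vᵢᵀ z)² ≥ σ_{k+1}² ‖z‖²` in the proof of the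
Eckart–Young theorem. [cite: GolubVanLoan2013, §2.4.2 Thm 2.4.8] -/
theorem singularValues_mul_norm_le_of_inner_eigenvectorBasis_eq_zero (T : E →ₗ[𝕜] F)
    (hn : finrank 𝕜 E = n) (k : ℕ) {x : E}
    (hx : ∀ i : Fin n, k < (i : ℕ) →
      ⟪T.isSymmetric_adjoint_comp_self.eigenvectorBasis hn i, x⟫_𝕜 = 0) :
    T.singularValues k * ‖x‖ ≤ ‖T x‖ := by
  by_cases hk : k < n
  · have h := Literature.Analysis.InnerProduct.le_re_inner_apply_self_of_inner_eq_zero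
      T.isSymmetric_adjoint_comp_self hn ⟨k, hk⟩ (x := x) (fun i hi => hx i hi)
    rw [re_inner_adjoint_comp_self_apply, ← T.sq_singularValues_of_lt hn hk, ← mul_pow] at h
    exact le_of_sq_le_sq h (norm_nonneg _)
  · rw [T.singularValues_of_finrank_le (hn.trans_le (not_lt.mp hk)), zero_mul]
    exact norm_nonneg _

/-- **The singular values are attained on the right singular vectors**: `‖T v_k‖ = σ_k`
(`A vᵢ = σᵢ uᵢ` with `‖uᵢ‖ = 1`). [cite: GolubVanLoan2013, §2.4.2 Cor 2.4.2] -/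
theorem norm_apply_eigenvectorBasis_eq_singularValues (T : E →ₗ[𝕜] F) (hn : finrank 𝕜 E = n)
    (k : Fin n) :
    ‖T (T.isSymmetric_adjoint_comp_self.eigenvectorBasis hn k)‖ = T.singularValues k := by
  set b := T.isSymmetric_adjoint_comp_self.eigenvectorBasis hn with hb
  have h1 := norm_apply_le_of_inner_eigenvectorBasis_eq_zero T hn k (x := b k)
    (fun i hi => b.orthonormal.2 (fun h => by rw [h] at hi; exact lt_irrefl _ hi))
  have h2 := singularValues_mul_norm_le_of_inner_eigenvectorBasis_eq_zero T hn k (x := b k)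
    (fun i hi => b.orthonormal.2 (fun h => by rw [h] at hi; exact lt_irrefl _ hi))
  rw [b.orthonormal.1 k, mul_one] at h1 h2
  exact le_antisymm h1 h2

/-- **`‖T x‖ ≤ σ₀ ‖x‖`** (`σ₀ = σ_max`; `‖A x‖₂ ≤ σ_max(A) ‖x‖₂`).
[cite: GolubVanLoan2013, §2.4.2 Cor 2.4.4 (proof)] -/
theorem norm_apply_le_singularValues_zero_mul_norm (T : E →ₗ[𝕜] F) (x : E) :
    ‖T x‖ ≤ T.singularValues 0 * ‖x‖ :=
  norm_apply_le_of_inner_eigenvectorBasis_eq_zero T rfl 0 fun _ hi => absurd hi (Nat.not_lt_zero _)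

/-- **`σ_{dim E − 1} ‖x‖ ≤ ‖T x‖`** (`σ_min`, the last singular value when `dim E ≤ dim F`:
`σ_min(A) ‖x‖₂ ≤ ‖A x‖₂` for `m ≥ n`; for `dim E > dim F` both sides say nothing as the indexed
singular value is `0`). [cite: GolubVanLoan2013, §2.4.2 Cor 2.4.4 (proof)]
[cite: GolubVanLoan2013, §8.6.2 Thm 8.6.1] -/
theorem singularValues_finrank_sub_one_mul_norm_le (T : E →ₗ[𝕜] F) (x : E) :
    T.singularValues (finrank 𝕜 E - 1) * ‖x‖ ≤ ‖T x‖ :=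
  singularValues_mul_norm_le_of_inner_eigenvectorBasis_eq_zero T rfl _ fun i hi => by
    exfalso
    have := i.isLt
    omega

/-- **`σ₀ = ‖T‖₂`**: the largest singular value is the operator norm.
[cite: GolubVanLoan2013, §2.4.2 Cor 2.4.3] -/
theorem singularValues_zero_eq_opNorm (T : E →ₗ[𝕜] F) :
    T.singularValues 0 = ‖LinearMap.toContinuousLinearMap T‖ := by
  refine le_antisymm ?_ (ContinuousLinearMap.opNorm_le_bound _ (T.singularValues_nonneg 0)
    fun x => ?_)
  · obtain ⟨n, hn⟩ : ∃ n, finrank 𝕜 E = n := ⟨_, rfl⟩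
    rcases Nat.eq_zero_or_pos n with h0 | hpos
    · rw [T.singularValues_of_finrank_le (by omega)]
      exact norm_nonneg _
    · set b := T.isSymmetric_adjoint_comp_self.eigenvectorBasis hn with hb
      have hop : ‖T (b ⟨0, hpos⟩)‖ ≤ ‖LinearMap.toContinuousLinearMap T‖ * ‖b ⟨0, hpos⟩‖ :=
        (LinearMap.toContinuousLinearMap T).le_opNorm (b ⟨0, hpos⟩)
      rw [b.orthonormal.1, mul_one, norm_apply_eigenvectorBasis_eq_singularValues T hn] at hop
      exact hop
  · have h := norm_apply_le_singularValues_zero_mul_norm T x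
    rwa [← LinearMap.coe_toContinuousLinearMap' T] at h

/-! ### Courant–Fischer for singular values (trial-subspace form) -/

/-- **Courant–Fischer for singular values, min–max half.**  If `‖T x‖ ≤ c ‖x‖` on a subspace
`W` with `dim W ≥ dim E − k` (and `c ≥ 0`), then `σ_k ≤ c`:
`σ_k = min_{dim W = n − k} max_{0 ≠ x ∈ W} ‖T x‖ / ‖x‖` (zero-indexed `k`).
[cite: HornJohnson2013, §7.3 Thm 7.3.8] [cite: GolubVanLoan2013, §8.6.2 Thm 8.6.1] -/
theorem singularValues_le_of_forall_mem_norm_apply_le (T : E →ₗ[𝕜] F) (hn : finrank 𝕜 E = n)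
    (k : ℕ) (W : Submodule 𝕜 E) (hW : n ≤ finrank 𝕜 W + k) {c : ℝ} (hc0 : 0 ≤ c)
    (hc : ∀ x ∈ W, ‖T x‖ ≤ c * ‖x‖) : T.singularValues k ≤ c := by
  by_cases hk : k < n
  · have h := Literature.Analysis.InnerProduct.eigenvalues_le_of_forall_mem
      T.isSymmetric_adjoint_comp_self hn ⟨k, hk⟩ W hW (μ := c ^ 2) fun x hx => by
        rw [re_inner_adjoint_comp_self_apply, ← mul_pow]
        exact pow_le_pow_left₀ (norm_nonneg _) (hc x hx) 2
    rw [← T.sq_singularValues_of_lt hn hk] at h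
    exact le_of_sq_le_sq h hc0
  · rw [T.singularValues_of_finrank_le (hn.trans_le (not_lt.mp hk))]
    exact hc0

/-- **Courant–Fischer for singular values, max–min half.**  If `c ‖x‖ ≤ ‖T x‖` on a subspace
`W` with `dim W ≥ k + 1`, then `c ≤ σ_k`:
`σ_k = max_{dim W = k + 1} min_{0 ≠ x ∈ W} ‖T x‖ / ‖x‖` (zero-indexed `k`).
[cite: HornJohnson2013, §7.3 Thm 7.3.8] [cite: GolubVanLoan2013, §8.6.2 Thm 8.6.1] -/
theorem le_singularValues_of_forall_mem_le_norm_apply (T : E →ₗ[𝕜] F) (hn : finrank 𝕜 E = n)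
    (k : ℕ) (W : Submodule 𝕜 E) (hW : k + 1 ≤ finrank 𝕜 W) {c : ℝ}
    (hc : ∀ x ∈ W, c * ‖x‖ ≤ ‖T x‖) : c ≤ T.singularValues k := by
  have hk : k < n := by
    have := Submodule.finrank_le W
    rw [hn] at this
    omega
  rcases le_or_gt c 0 with hc0 | hc0
  · exact hc0.trans (T.singularValues_nonneg k)
  · have h := Literature.Analysis.InnerProduct.le_eigenvalues_of_forall_mem
      T.isSymmetric_adjoint_comp_self hn ⟨k, hk⟩ W hW (c := c ^ 2) fun x hx => by
        rw [re_inner_adjoint_comp_self_apply, ← mul_pow]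
        exact pow_le_pow_left₀ (mul_nonneg hc0.le (norm_nonneg _)) (hc x hx) 2
    rw [← T.sq_singularValues_of_lt hn hk] at h
    exact le_of_sq_le_sq h (T.singularValues_nonneg k)

/-! ### The Eckart–Young–Mirsky theorem (spectral norm) -/

/-- **Eckart–Young–Mirsky, existence of the truncation.**  For every `k` there is a linear map
`S` of rank `≤ k` with `‖T x − S x‖ ≤ σ_k ‖x‖` for all `x` — namely `S = T ∘ P` with `P` the
orthogonal projection onto the span of the first `k` right singular vectors (`A_k = Σ_{i<k} σᵢ uᵢ
vᵢᵀ`, `‖A − A_k‖₂ = σ_{k+1}` one-indexed). [cite: GolubVanLoan2013, §2.4.2 Thm 2.4.8]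
[cite: HornJohnson2013, §7.4.9 (7.4.9.2)] [cite: EckartYoung1936, p. 216 Eq. (17)] -/
theorem exists_finrank_range_le_norm_sub_le (T : E →ₗ[𝕜] F) (k : ℕ) :
    ∃ S : E →ₗ[𝕜] F, finrank 𝕜 (LinearMap.range S) ≤ k ∧
      ∀ x, ‖T x - S x‖ ≤ T.singularValues k * ‖x‖ := by
  obtain ⟨n, hn⟩ : ∃ n, finrank 𝕜 E = n := ⟨_, rfl⟩
  by_cases hk : n ≤ k
  · refine ⟨T, (LinearMap.finrank_range_le T).trans (hn.le.trans hk), fun x => ?_⟩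
    rw [sub_self, norm_zero]
    exact mul_nonneg (T.singularValues_nonneg k) (norm_nonneg x)
  rw [not_le] at hk
  set b := T.isSymmetric_adjoint_comp_self.eigenvectorBasis hn with hb
  obtain ⟨K, hK⟩ : ∃ K : Submodule 𝕜 E,
      K = Submodule.span 𝕜 (Set.range fun j : Fin k => b (Fin.castLE hk.le j)) := ⟨_, rfl⟩
  haveI : CompleteSpace K := FiniteDimensional.complete 𝕜 K
  refine ⟨T ∘ₗ (K.starProjection : E →L[𝕜] E).toLinearMap, ?_, fun x => ?_⟩
  · have h1 : LinearMap.range (T ∘ₗ (K.starProjection : E →L[𝕜] E).toLinearMap) ≤ K.map T := by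
      rintro _ ⟨x, rfl⟩
      exact ⟨K.starProjection x, K.starProjection_apply_mem x, rfl⟩
    have h2 : finrank 𝕜 K ≤ k := by
      have h := finrank_range_le_card (R := 𝕜) fun j : Fin k => b (Fin.castLE hk.le j)
      rw [hK]
      simpa [Set.finrank] using h
    exact (Submodule.finrank_mono h1).trans ((Submodule.finrank_map_le T K).trans h2)
  · have hy : x - K.starProjection x ∈ Kᗮ := K.sub_starProjection_mem_orthogonal x
    have horth : ∀ i : Fin n, (i : ℕ) < k → ⟪b i, x - K.starProjection x⟫_𝕜 = 0 := by
      intro i hi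
      have hmem : b i ∈ K := by
        rw [hK]
        exact Submodule.subset_span ⟨⟨i, hi⟩, rfl⟩
      exact Submodule.inner_right_of_mem_orthogonal hmem hy
    have hle := norm_apply_le_of_inner_eigenvectorBasis_eq_zero T hn k horth
    have hPy : ‖x - K.starProjection x‖ ≤ ‖x‖ := by
      have h0 : ⟪x - K.starProjection x, K.starProjection x⟫_𝕜 = 0 :=
        Submodule.inner_left_of_mem_orthogonal (K.starProjection_apply_mem x) hy
      have hpy := norm_add_sq_eq_norm_sq_add_norm_sq_of_inner_eq_zero _ _ h0
      rw [sub_add_cancel] at hpy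
      have hsq : ‖x - K.starProjection x‖ ^ 2 ≤ ‖x‖ ^ 2 := by
        rw [sq, sq, hpy]
        linarith [mul_self_nonneg ‖K.starProjection x‖]
      exact le_of_sq_le_sq hsq (norm_nonneg x)
    calc ‖T x - (T ∘ₗ (K.starProjection : E →L[𝕜] E).toLinearMap) x‖
          = ‖T (x - K.starProjection x)‖ := by
            rw [map_sub, LinearMap.comp_apply, ContinuousLinearMap.coe_coe]
      _ ≤ T.singularValues k * ‖x - K.starProjection x‖ := hle
      _ ≤ T.singularValues k * ‖x‖ :=
            mul_le_mul_of_nonneg_left hPy (T.singularValues_nonneg k)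

/-- **Eckart–Young–Mirsky, optimality.**  If `S` has rank `≤ k` and `‖T x − S x‖ ≤ c ‖x‖` for
all `x` (with `c ≥ 0`), then `σ_k(T) ≤ c`: no rank-`≤ k` map approximates `T` better than the
truncation, `min_{rank B ≤ k} ‖A − B‖₂ = σ_{k+1}` (one-indexed).  Proof as in the source:
`dim ker S ≥ dim E − k`, and on `ker S` the map `T − S` is `T`; conclude by Courant–Fischer.
[cite: GolubVanLoan2013, §2.4.2 Thm 2.4.8] [cite: HornJohnson2013, §7.4.9 (7.4.9.2)] -/
theorem singularValues_le_of_finrank_range_le (T S : E →ₗ[𝕜] F) {k : ℕ}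
    (hS : finrank 𝕜 (LinearMap.range S) ≤ k) {c : ℝ} (hc0 : 0 ≤ c)
    (hc : ∀ x, ‖T x - S x‖ ≤ c * ‖x‖) : T.singularValues k ≤ c := by
  obtain ⟨n, hn⟩ : ∃ n, finrank 𝕜 E = n := ⟨_, rfl⟩
  refine singularValues_le_of_forall_mem_norm_apply_le T hn k (LinearMap.ker S) ?_ hc0
    fun x hx => ?_
  · have h := S.finrank_range_add_finrank_ker
    rw [hn] at h
    omega
  · rw [LinearMap.mem_ker] at hx
    have h := hc x
    rwa [hx, sub_zero] at h

/-- **Eckart–Young–Mirsky, the extremal vector.**  If `rank S ≤ k < dim E` there is a non-zero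
`x ∈ ker S` with `σ_k ‖x‖ ≤ ‖T x − S x‖` (a unit vector in `null(B) ∩ span {v₁, …, v_{k+1}}`, which
is non-trivial by the dimension count `(n − k) + (k + 1) > n`).
[cite: GolubVanLoan2013, §2.4.2 Thm 2.4.8] -/
theorem exists_ne_zero_singularValues_mul_norm_le (T S : E →ₗ[𝕜] F) (hn : finrank 𝕜 E = n)
    {k : ℕ} (hk : k < n) (hS : finrank 𝕜 (LinearMap.range S) ≤ k) :
    ∃ x : E, x ≠ 0 ∧ S x = 0 ∧ T.singularValues k * ‖x‖ ≤ ‖T x - S x‖ := by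
  have e1 : finrank 𝕜 (Submodule.span 𝕜 (Set.range fun j : {j : Fin n // j ≤ (⟨k, hk⟩ : Fin n)} =>
      T.isSymmetric_adjoint_comp_self.eigenvectorBasis hn j)) = k + 1 :=
    Literature.Analysis.InnerProduct.finrank_headSpan T.isSymmetric_adjoint_comp_self hn ⟨k, hk⟩
  have e2 := S.finrank_range_add_finrank_ker
  rw [hn] at e2
  obtain ⟨x, hxW, hxV, hx0⟩ :=
    Literature.Analysis.InnerProduct.exists_mem_inf_ne_zero_of_finrank_lt (LinearMap.ker S)
      (Submodule.span 𝕜 (Set.range fun j : {j : Fin n // j ≤ (⟨k, hk⟩ : Fin n)} =>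
        T.isSymmetric_adjoint_comp_self.eigenvectorBasis hn j))
      (by rw [e1, hn]; omega)
  rw [LinearMap.mem_ker] at hxW
  refine ⟨x, hx0, hxW, ?_⟩
  rw [hxW, sub_zero]
  exact singularValues_mul_norm_le_of_inner_eigenvectorBasis_eq_zero T hn k fun i hi =>
    Literature.Analysis.InnerProduct.inner_eq_zero_of_mem_headSpan
      T.isSymmetric_adjoint_comp_self hn ⟨k, hk⟩ hxV i hi

/-! ### Weyl's perturbation inequality and interlacing under compression -/

/-- **Weyl's inequality for singular values, one-sided.**  If `‖T x − T' x‖ ≤ c ‖x‖` for all `x`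
(with `c ≥ 0`), then `σ_k(T) ≤ σ_k(T') + c` for every `k`: combine the rank-`≤ k` truncation of `T'`
with the triangle inequality and Eckart–Young optimality for `T`.
[cite: GolubVanLoan2013, §8.6.2 Cor 8.6.2] [cite: HornJohnson2013, §7.3 Cor 7.3.5 (a)] -/
theorem singularValues_le_singularValues_add_of_norm_sub_le (T T' : E →ₗ[𝕜] F) {c : ℝ}
    (hc0 : 0 ≤ c) (hc : ∀ x, ‖T x - T' x‖ ≤ c * ‖x‖) (k : ℕ) :
    T.singularValues k ≤ T'.singularValues k + c := by
  obtain ⟨S, hS, hSx⟩ := exists_finrank_range_le_norm_sub_le T' k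
  refine singularValues_le_of_finrank_range_le T S hS
    (add_nonneg (T'.singularValues_nonneg k) hc0) fun x => ?_
  calc ‖T x - S x‖ = ‖(T x - T' x) + (T' x - S x)‖ := by rw [sub_add_sub_cancel]
    _ ≤ ‖T x - T' x‖ + ‖T' x - S x‖ := norm_add_le _ _
    _ ≤ c * ‖x‖ + T'.singularValues k * ‖x‖ := add_le_add (hc x) (hSx x)
    _ = (T'.singularValues k + c) * ‖x‖ := by ring

/-- **Weyl's perturbation theorem for singular values** (Mirsky): if `‖T x − T' x‖ ≤ c ‖x‖` for
all `x`, then `|σ_k(T) − σ_k(T')| ≤ c` for every `k` (`|σ_k(A + E) − σ_k(A)| ≤ ‖E‖₂`).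
[cite: GolubVanLoan2013, §8.6.2 Cor 8.6.2] [cite: HornJohnson2013, §7.3 Cor 7.3.5 (a)] -/
theorem abs_singularValues_sub_le (T T' : E →ₗ[𝕜] F) {c : ℝ} (hc0 : 0 ≤ c)
    (hc : ∀ x, ‖T x - T' x‖ ≤ c * ‖x‖) (k : ℕ) :
    |T.singularValues k - T'.singularValues k| ≤ c := by
  rw [abs_sub_le_iff]
  constructor
  · linarith [singularValues_le_singularValues_add_of_norm_sub_le T T' hc0 hc k]
  · linarith [singularValues_le_singularValues_add_of_norm_sub_le T' T hc0
      (fun x => by rw [norm_sub_rev]; exact hc x) k]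

/-- **Weyl's perturbation theorem, operator-norm form**: `|σ_k(T) − σ_k(T')| ≤ ‖T − T'‖₂`.
[cite: GolubVanLoan2013, §8.6.2 Cor 8.6.2] [cite: HornJohnson2013, §7.3 Cor 7.3.5 (a)] -/
theorem abs_singularValues_sub_le_opNorm_sub (T T' : E →ₗ[𝕜] F) (k : ℕ) :
    |T.singularValues k - T'.singularValues k| ≤ ‖LinearMap.toContinuousLinearMap (T - T')‖ :=
  abs_singularValues_sub_le T T' (norm_nonneg _)
    (fun x => by simpa using (LinearMap.toContinuousLinearMap (T - T')).le_opNorm x) k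

/-- **Singular values of a compression.**  For linear maps `π`, `ι` with `‖π y‖ ≤ p ‖y‖` and
`‖ι x‖ ≤ q ‖x‖` (`p, q ≥ 0`): `σ_k(π ∘ T ∘ ι) ≤ p q σ_k(T)` — the rank-`≤ k` truncation `S` of `T`
compresses to a rank-`≤ k` approximation `π ∘ S ∘ ι` of `π ∘ T ∘ ι`.  With `p = q = 1` (a
coordinate projection and a coordinate injection) this is the interlacing `σ_k(Â) ≤ σ_k(A)` for
submatrices. [cite: HornJohnson2013, §7.3 Cor 7.3.6 (7.3.7)]
[cite: GolubVanLoan2013, §8.6.2 Cor 8.6.3] -/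
theorem singularValues_comp_le_mul {E' F' : Type*} [NormedAddCommGroup E'] [InnerProductSpace 𝕜 E']
    [FiniteDimensional 𝕜 E'] [NormedAddCommGroup F'] [InnerProductSpace 𝕜 F']
    [FiniteDimensional 𝕜 F'] (T : E →ₗ[𝕜] F) (π : F →ₗ[𝕜] F') (ι : E' →ₗ[𝕜] E) {p q : ℝ}
    (hp : 0 ≤ p) (hq : 0 ≤ q) (hπ : ∀ y, ‖π y‖ ≤ p * ‖y‖) (hι : ∀ x, ‖ι x‖ ≤ q * ‖x‖) (k : ℕ) :
    (π ∘ₗ T ∘ₗ ι).singularValues k ≤ p * q * T.singularValues k := by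
  obtain ⟨S, hS, hSx⟩ := exists_finrank_range_le_norm_sub_le T k
  refine singularValues_le_of_finrank_range_le (π ∘ₗ T ∘ₗ ι) (π ∘ₗ S ∘ₗ ι) ?_
    (mul_nonneg (mul_nonneg hp hq) (T.singularValues_nonneg k)) fun x => ?_
  · have h1 : LinearMap.range (π ∘ₗ S ∘ₗ ι) ≤ (LinearMap.range S).map π := by
      rintro _ ⟨x, rfl⟩
      exact ⟨S (ι x), LinearMap.mem_range_self S (ι x), rfl⟩
    exact (Submodule.finrank_mono h1).trans ((Submodule.finrank_map_le π _).trans hS)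
  · calc ‖(π ∘ₗ T ∘ₗ ι) x - (π ∘ₗ S ∘ₗ ι) x‖ = ‖π (T (ι x) - S (ι x))‖ := by
          simp only [LinearMap.comp_apply, map_sub]
      _ ≤ p * ‖T (ι x) - S (ι x)‖ := hπ _
      _ ≤ p * (T.singularValues k * ‖ι x‖) := mul_le_mul_of_nonneg_left (hSx _) hp
      _ ≤ p * (T.singularValues k * (q * ‖x‖)) :=
          mul_le_mul_of_nonneg_left
            (mul_le_mul_of_nonneg_left (hι x) (T.singularValues_nonneg k)) hp
      _ = p * q * T.singularValues k * ‖x‖ := by ring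

/-- **Interlacing under compression by contractions**: if `‖π y‖ ≤ ‖y‖` and `‖ι x‖ ≤ ‖x‖` then
`σ_k(π ∘ T ∘ ι) ≤ σ_k(T)` for every `k`. [cite: HornJohnson2013, §7.3 Cor 7.3.6 (7.3.7)]
[cite: GolubVanLoan2013, §8.6.2 Cor 8.6.3] -/
theorem singularValues_comp_le_of_norm_le {E' F' : Type*} [NormedAddCommGroup E']
    [InnerProductSpace 𝕜 E'] [FiniteDimensional 𝕜 E'] [NormedAddCommGroup F']
    [InnerProductSpace 𝕜 F'] [FiniteDimensional 𝕜 F'] (T : E →ₗ[𝕜] F) (π : F →ₗ[𝕜] F')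
    (ι : E' →ₗ[𝕜] E) (hπ : ∀ y, ‖π y‖ ≤ ‖y‖) (hι : ∀ x, ‖ι x‖ ≤ ‖x‖) (k : ℕ) :
    (π ∘ₗ T ∘ₗ ι).singularValues k ≤ T.singularValues k := by
  have h := singularValues_comp_le_mul T π ι zero_le_one zero_le_one
    (fun y => by rw [one_mul]; exact hπ y) (fun x => by rw [one_mul]; exact hι x) k
  rwa [one_mul, one_mul] at h

end Operator

/-! ## Part II. Rectangular matrices (`Matrix.toEuclideanLin`) -/

section MatrixForms

variable {𝕜 : Type*} [RCLike 𝕜] {m n : Type*} [Fintype m] [Fintype n] [DecidableEq n]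

/-- [folklore] Transport of `LinearMap.IsSymmetric.eigenvalues` along an equality of operators. -/
private theorem isSymmetric_eigenvalues_congr {E : Type*} [NormedAddCommGroup E]
    [InnerProductSpace 𝕜 E] [FiniteDimensional 𝕜 E] {T T' : E →ₗ[𝕜] E} (h : T = T')
    (hT : T.IsSymmetric) (hT' : T'.IsSymmetric) {d : ℕ} (hd : finrank 𝕜 E = d) :
    hT.eigenvalues hd = hT'.eigenvalues hd := by
  subst h
  rfl

/-- **`σ_k(A)² = λ_k(AᴴA)`**: the squares of the singular values of a matrix are the eigenvalues
of `AᴴA`, both in antitone order (`Matrix.IsHermitian.eigenvalues₀`), for `k < |n|`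
(`AᵀA vᵢ = σᵢ² vᵢ`; `σ_k²(A) = λ_{m−k+1}(A^*A)` in increasing order).
[cite: GolubVanLoan2013, §2.4.2 (2.4.1)] [cite: HornJohnson2013, §7.3 Thm 7.3.8] -/
theorem sq_singularValues_toEuclideanLin (A : Matrix m n 𝕜) (k : Fin (Fintype.card n)) :
    (Matrix.toEuclideanLin A).singularValues k ^ 2 =
      (Matrix.isHermitian_conjTranspose_mul_self A).eigenvalues₀ k := by
  classical
  have h : LinearMap.adjoint (Matrix.toEuclideanLin A) ∘ₗ Matrix.toEuclideanLin A =
      Matrix.toEuclideanLin (A.conjTranspose * A) := by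
    rw [← Matrix.toEuclideanLin_conjTranspose_eq_adjoint]
    exact (Matrix.toLpLin_mul_same 2 A.conjTranspose A).symm
  rw [(Matrix.toEuclideanLin A).sq_singularValues_fin finrank_euclideanSpace k]
  exact congrFun (isSymmetric_eigenvalues_congr h
    (Matrix.toEuclideanLin A).isSymmetric_adjoint_comp_self
    (Matrix.isSymmetric_toEuclideanLin_iff.mpr (Matrix.isHermitian_conjTranspose_mul_self A))
    finrank_euclideanSpace) k

/-- [folklore] `rank A = dim range (toEuclideanLin A)` (Mathlib's
`Matrix.rank_eq_finrank_range_toLin` for the Euclidean standard bases). -/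
private theorem rank_eq_finrank_range_toEuclideanLin (A : Matrix m n 𝕜) :
    A.rank = finrank 𝕜 (LinearMap.range (Matrix.toEuclideanLin A)) :=
  Matrix.rank_eq_finrank_range_toLin A (EuclideanSpace.basisFun m 𝕜).toBasis
    (EuclideanSpace.basisFun n 𝕜).toBasis

/-- **`σ_k(A) = 0 ↔ rank A ≤ k`** (zero-indexed: `rank A = r ⇔ σ_r > σ_{r+1} = 0` one-indexed).
[cite: GolubVanLoan2013, §2.4.2 Cor 2.4.6] -/
theorem singularValues_toEuclideanLin_eq_zero_iff_rank_le (A : Matrix m n 𝕜) (k : ℕ) :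
    (Matrix.toEuclideanLin A).singularValues k = 0 ↔ A.rank ≤ k := by
  rw [LinearMap.singularValues_eq_zero_iff_le_finrank_range, rank_eq_finrank_range_toEuclideanLin]

/-- **`σ_{|n| − 1}(A) ‖x‖ ≤ ‖A x‖`** for `A : Matrix m n 𝕜` (`σ_min(A) ‖x‖₂ ≤ ‖A x‖₂` when
`|m| ≥ |n|`). [cite: GolubVanLoan2013, §2.4.2 Cor 2.4.4 (proof)]
[cite: GolubVanLoan2013, §8.6.2 Thm 8.6.1] -/
theorem singularValues_card_sub_one_mul_norm_le (A : Matrix m n 𝕜) (x : EuclideanSpace 𝕜 n) :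
    (Matrix.toEuclideanLin A).singularValues (Fintype.card n - 1) * ‖x‖ ≤
      ‖Matrix.toEuclideanLin A x‖ := by
  have h := singularValues_finrank_sub_one_mul_norm_le (Matrix.toEuclideanLin A) x
  rwa [finrank_euclideanSpace] at h

/-! ### Entrywise versus spectral size -/

/-- [folklore] **`|M i j| ≤ ‖M e_j‖₂`** (so `max |a_ij| ≤ ‖A‖₂`, [GolubVanLoan2013, (2.3.8)]).
[cite: GolubVanLoan2013, §2.3.2 (2.3.8)] -/
theorem norm_entry_le_norm_toEuclideanLin_single (M : Matrix m n 𝕜) (i : m) (j : n) :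
    ‖M i j‖ ≤ ‖Matrix.toEuclideanLin M (EuclideanSpace.single j (1 : 𝕜))‖ := by
  have h : (Matrix.toEuclideanLin M (EuclideanSpace.single j (1 : 𝕜))) i = M i j := by
    simp [Matrix.toLpLin_apply, PiLp.ofLp_single]
  calc ‖M i j‖ = ‖(Matrix.toEuclideanLin M (EuclideanSpace.single j (1 : 𝕜))) i‖ := by rw [h]
    _ ≤ _ := PiLp.norm_apply_le _ i

/-- **`‖M x‖₂ ≤ √(|m| |n|) δ ‖x‖₂` when all `|M i j| ≤ δ`** (`‖A‖₂ ≤ √(mn) max |a_ij|`): row-wise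
Cauchy–Schwarz. [cite: GolubVanLoan2013, §2.3.2 (2.3.8)] -/
theorem norm_toEuclideanLin_le_of_forall_norm_entry_le (M : Matrix m n 𝕜) {δ : ℝ} (hδ : 0 ≤ δ)
    (hM : ∀ i j, ‖M i j‖ ≤ δ) (x : EuclideanSpace 𝕜 n) :
    ‖Matrix.toEuclideanLin M x‖ ≤ √(Fintype.card m * Fintype.card n) * δ * ‖x‖ := by
  have hrow : ∀ i, ‖(Matrix.toEuclideanLin M x) i‖ ^ 2 ≤
      Fintype.card n * δ ^ 2 * ‖x‖ ^ 2 := by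
    intro i
    have h1 : ‖(Matrix.toEuclideanLin M x) i‖ ≤ ∑ j, ‖M i j‖ * ‖x j‖ := by
      have e : (Matrix.toEuclideanLin M x) i = ∑ j, M i j * x j := by
        simp [Matrix.toLpLin_apply, Matrix.mulVec, dotProduct]
      rw [e]
      exact (norm_sum_le _ _).trans (le_of_eq (Finset.sum_congr rfl fun j _ => norm_mul _ _))
    have h2 : (∑ j, ‖M i j‖ * ‖x j‖) ^ 2 ≤ (∑ j, ‖M i j‖ ^ 2) * ∑ j, ‖x j‖ ^ 2 :=
      Finset.sum_mul_sq_le_sq_mul_sq _ _ _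
    have h3 : ∑ j, ‖M i j‖ ^ 2 ≤ Fintype.card n * δ ^ 2 := by
      calc ∑ j, ‖M i j‖ ^ 2 ≤ ∑ _j : n, δ ^ 2 :=
            Finset.sum_le_sum fun j _ => pow_le_pow_left₀ (norm_nonneg _) (hM i j) 2
        _ = Fintype.card n * δ ^ 2 := by
            simp only [Finset.sum_const, Finset.card_univ, nsmul_eq_mul]
    rw [← EuclideanSpace.norm_sq_eq x] at h2
    calc ‖(Matrix.toEuclideanLin M x) i‖ ^ 2 ≤ (∑ j, ‖M i j‖ * ‖x j‖) ^ 2 :=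
          pow_le_pow_left₀ (norm_nonneg _) h1 2
      _ ≤ (∑ j, ‖M i j‖ ^ 2) * ‖x‖ ^ 2 := h2
      _ ≤ Fintype.card n * δ ^ 2 * ‖x‖ ^ 2 := mul_le_mul_of_nonneg_right h3 (sq_nonneg _)
  have hsq : ‖Matrix.toEuclideanLin M x‖ ^ 2 ≤
      (√(Fintype.card m * Fintype.card n) * δ * ‖x‖) ^ 2 := by
    rw [EuclideanSpace.norm_sq_eq (Matrix.toEuclideanLin M x), mul_pow, mul_pow,
      Real.sq_sqrt (by positivity)]
    calc ∑ i, ‖(Matrix.toEuclideanLin M x) i‖ ^ 2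
          ≤ ∑ _i : m, Fintype.card n * δ ^ 2 * ‖x‖ ^ 2 := Finset.sum_le_sum fun i _ => hrow i
      _ = Fintype.card m * Fintype.card n * δ ^ 2 * ‖x‖ ^ 2 := by
          simp only [Finset.sum_const, Finset.card_univ, nsmul_eq_mul]
          ring
  exact le_of_sq_le_sq hsq (by positivity)

/-- **`|A i j| ≤ σ₀(A)`** (`max |a_ij| ≤ ‖A‖₂ = σ₁` one-indexed).
[cite: GolubVanLoan2013, §2.3.2 (2.3.8)] [cite: GolubVanLoan2013, §2.4.2 Cor 2.4.3] -/
theorem norm_entry_le_singularValues_zero (A : Matrix m n 𝕜) (i : m) (j : n) :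
    ‖A i j‖ ≤ (Matrix.toEuclideanLin A).singularValues 0 := by
  calc ‖A i j‖ ≤ ‖Matrix.toEuclideanLin A (EuclideanSpace.single j (1 : 𝕜))‖ :=
        norm_entry_le_norm_toEuclideanLin_single A i j
    _ ≤ (Matrix.toEuclideanLin A).singularValues 0 * ‖EuclideanSpace.single j (1 : 𝕜)‖ :=
        norm_apply_le_singularValues_zero_mul_norm _ _
    _ = (Matrix.toEuclideanLin A).singularValues 0 := by
        rw [PiLp.norm_single, norm_one, mul_one]

/-! ### Eckart–Young–Mirsky for matrices, and the entrywise bridge -/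

/-- **Eckart–Young optimality for matrices**: if `rank B ≤ k` and `‖(A − B) x‖ ≤ c ‖x‖` for all
`x` (with `c ≥ 0`) then `σ_k(A) ≤ c`, i.e. `σ_{k+1}(A) ≤ ‖A − B‖₂` for every `B` of rank `≤ k`
(one-indexed). [cite: GolubVanLoan2013, §2.4.2 Thm 2.4.8] -/
theorem singularValues_toEuclideanLin_le_of_rank_le (A B : Matrix m n 𝕜) {k : ℕ} (hB : B.rank ≤ k)
    {c : ℝ} (hc0 : 0 ≤ c) (hc : ∀ x, ‖Matrix.toEuclideanLin (A - B) x‖ ≤ c * ‖x‖) :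
    (Matrix.toEuclideanLin A).singularValues k ≤ c := by
  refine singularValues_le_of_finrank_range_le (Matrix.toEuclideanLin A) (Matrix.toEuclideanLin B)
    (by rwa [← rank_eq_finrank_range_toEuclideanLin]) hc0 fun x => ?_
  rw [← LinearMap.sub_apply, ← map_sub]
  exact hc x

/-- **Eckart–Young–Mirsky for matrices (spectral norm), with the entrywise consequence.**  For
every `k` there is a matrix `B` of rank `≤ k` with `‖(A − B) x‖₂ ≤ σ_k(A) ‖x‖₂` for all `x` — so
`min_{rank B ≤ k} ‖A − B‖₂ = σ_{k+1}(A)` one-indexed, attained at the truncated SVD — and hence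
`|A i j − B i j| ≤ σ_k(A)` for all entries (`max |e_ij| ≤ ‖E‖₂`).  This is the matrix `F` of rank
`≤ k`, entrywise `σ_k(A)`-close to `A`, that the cross-approximation bounds of this directory are
stated against. [cite: GolubVanLoan2013, §2.4.2 Thm 2.4.8] [cite: HornJohnson2013, §7.4.9 (7.4.9.2)]
[cite: GolubVanLoan2013, §2.3.2 (2.3.8)] -/
theorem exists_rank_le_norm_toEuclideanLin_sub_le (A : Matrix m n 𝕜) (k : ℕ) :
    ∃ B : Matrix m n 𝕜, B.rank ≤ k ∧
      (∀ x, ‖Matrix.toEuclideanLin (A - B) x‖ ≤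
        (Matrix.toEuclideanLin A).singularValues k * ‖x‖) ∧
      ∀ i j, ‖A i j - B i j‖ ≤ (Matrix.toEuclideanLin A).singularValues k := by
  obtain ⟨S, hS, hSx⟩ := exists_finrank_range_le_norm_sub_le (Matrix.toEuclideanLin A) k
  set B : Matrix m n 𝕜 := Matrix.toEuclideanLin.symm S with hB
  have hTB : Matrix.toEuclideanLin B = S := LinearEquiv.apply_symm_apply _ _
  have h2 : ∀ x, ‖Matrix.toEuclideanLin (A - B) x‖ ≤
      (Matrix.toEuclideanLin A).singularValues k * ‖x‖ := fun x => by
    rw [map_sub, hTB, LinearMap.sub_apply]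
    exact hSx x
  refine ⟨B, ?_, h2, fun i j => ?_⟩
  · rw [rank_eq_finrank_range_toEuclideanLin, hTB]
    exact hS
  · calc ‖A i j - B i j‖ = ‖(A - B) i j‖ := by rw [Matrix.sub_apply]
      _ ≤ ‖Matrix.toEuclideanLin (A - B) (EuclideanSpace.single j (1 : 𝕜))‖ :=
          norm_entry_le_norm_toEuclideanLin_single _ i j
      _ ≤ (Matrix.toEuclideanLin A).singularValues k * ‖EuclideanSpace.single j (1 : 𝕜)‖ := h2 _
      _ = (Matrix.toEuclideanLin A).singularValues k := by
          rw [PiLp.norm_single, norm_one, mul_one]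

/-- **The entrywise converse**: if some matrix `B` of rank `≤ k` satisfies `|A i j − B i j| ≤ δ`
for all entries (`δ ≥ 0`), then `σ_k(A) ≤ √(|m| |n|) δ` — the best entrywise and the best
spectral-norm rank-`k` errors agree up to the factor `√(|m| |n|)` of `‖E‖₂ ≤ √(mn) max |e_ij|`.
[cite: GolubVanLoan2013, §2.4.2 Thm 2.4.8] [cite: GolubVanLoan2013, §2.3.2 (2.3.8)] -/
theorem singularValues_toEuclideanLin_le_sqrt_card_mul_of_rank_le (A B : Matrix m n 𝕜) {k : ℕ}
    (hB : B.rank ≤ k) {δ : ℝ} (hδ : 0 ≤ δ) (hAB : ∀ i j, ‖A i j - B i j‖ ≤ δ) :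
    (Matrix.toEuclideanLin A).singularValues k ≤ √(Fintype.card m * Fintype.card n) * δ :=
  singularValues_toEuclideanLin_le_of_rank_le A B hB (by positivity) fun x =>
    norm_toEuclideanLin_le_of_forall_norm_entry_le (A - B) hδ
      (fun i j => by rw [Matrix.sub_apply]; exact hAB i j) x

/-- **`σ₀(A) ≤ √(|m| |n|) max |a_ij|`**. [cite: GolubVanLoan2013, §2.3.2 (2.3.8)]
[cite: GolubVanLoan2013, §2.4.2 Cor 2.4.3] -/
theorem singularValues_toEuclideanLin_zero_le_sqrt_card_mul (A : Matrix m n 𝕜) {δ : ℝ}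
    (hδ : 0 ≤ δ) (hA : ∀ i j, ‖A i j‖ ≤ δ) :
    (Matrix.toEuclideanLin A).singularValues 0 ≤ √(Fintype.card m * Fintype.card n) * δ :=
  singularValues_toEuclideanLin_le_sqrt_card_mul_of_rank_le A 0 (by rw [Matrix.rank_zero]) hδ
    fun i j => by rw [Matrix.zero_apply, sub_zero]; exact hA i j

/-- **Weyl–Mirsky perturbation bound for matrices**: `‖(A − A') x‖ ≤ c ‖x‖` for all `x` gives
`|σ_k(A) − σ_k(A')| ≤ c`. [cite: GolubVanLoan2013, §8.6.2 Cor 8.6.2]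
[cite: HornJohnson2013, §7.3 Cor 7.3.5 (a)] -/
theorem abs_singularValues_toEuclideanLin_sub_le (A A' : Matrix m n 𝕜) {c : ℝ} (hc0 : 0 ≤ c)
    (hc : ∀ x, ‖Matrix.toEuclideanLin (A - A') x‖ ≤ c * ‖x‖) (k : ℕ) :
    |(Matrix.toEuclideanLin A).singularValues k - (Matrix.toEuclideanLin A').singularValues k|
      ≤ c :=
  abs_singularValues_sub_le _ _ hc0
    (fun x => by rw [← LinearMap.sub_apply, ← map_sub]; exact hc x) k

/-- **Weyl–Mirsky perturbation bound, entrywise form**: `|A i j − A' i j| ≤ δ` for all entries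
gives `|σ_k(A) − σ_k(A')| ≤ √(|m| |n|) δ`. [cite: GolubVanLoan2013, §8.6.2 Cor 8.6.2]
[cite: GolubVanLoan2013, §2.3.2 (2.3.8)] -/
theorem abs_singularValues_toEuclideanLin_sub_le_sqrt_card_mul (A A' : Matrix m n 𝕜) {δ : ℝ}
    (hδ : 0 ≤ δ) (hAA' : ∀ i j, ‖A i j - A' i j‖ ≤ δ) (k : ℕ) :
    |(Matrix.toEuclideanLin A).singularValues k - (Matrix.toEuclideanLin A').singularValues k|
      ≤ √(Fintype.card m * Fintype.card n) * δ :=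
  abs_singularValues_toEuclideanLin_sub_le A A' (by positivity) (fun x =>
    norm_toEuclideanLin_le_of_forall_norm_entry_le (A - A') hδ
      (fun i j => by rw [Matrix.sub_apply]; exact hAA' i j) x) k

/-! ### Interlacing for submatrices -/

/-- [folklore] **Row selection is a contraction**: `‖(y_{r i'})_{i'}‖₂ ≤ ‖y‖₂` for an injective
`r : m' → m` (the coordinate projection `1[r, ·]`). -/
private theorem norm_toEuclideanLin_one_submatrix_le {m' : Type*} [Fintype m'] [DecidableEq m]
    {r : m' → m} (hr : Function.Injective r) (y : EuclideanSpace 𝕜 m) :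
    ‖Matrix.toEuclideanLin ((1 : Matrix m m 𝕜).submatrix r id) y‖ ≤ ‖y‖ := by
  have happ : ∀ i',
      (Matrix.toEuclideanLin ((1 : Matrix m m 𝕜).submatrix r id) y) i' = y (r i') := by
    intro i'
    simp [Matrix.toLpLin_apply, Matrix.mulVec, dotProduct, Matrix.one_apply]
  have hsq : ‖Matrix.toEuclideanLin ((1 : Matrix m m 𝕜).submatrix r id) y‖ ^ 2 ≤ ‖y‖ ^ 2 := by
    rw [EuclideanSpace.norm_sq_eq (Matrix.toEuclideanLin ((1 : Matrix m m 𝕜).submatrix r id) y),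
      EuclideanSpace.norm_sq_eq y]
    simp_rw [happ]
    calc ∑ i', ‖y (r i')‖ ^ 2 = ∑ i ∈ Finset.univ.image r, ‖y i‖ ^ 2 := by
          rw [Finset.sum_image fun a _ b _ h => hr h]
      _ ≤ ∑ i, ‖y i‖ ^ 2 :=
          Finset.sum_le_sum_of_subset_of_nonneg (Finset.subset_univ _) fun i _ _ => sq_nonneg _
  exact le_of_sq_le_sq hsq (norm_nonneg y)

/-- [folklore] **Column extension by zero is a contraction** (in fact an isometry): for an
injective `c : n' → n` the coordinate injection `1[·, c]` satisfies `‖1[·, c] x‖₂ ≤ ‖x‖₂`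
(it is the adjoint of the row selection `1[c, ·]`). -/
private theorem norm_toEuclideanLin_one_submatrix_id_le {n' : Type*} [Fintype n'] [DecidableEq n']
    {c : n' → n} (hc : Function.Injective c) (x : EuclideanSpace 𝕜 n') :
    ‖Matrix.toEuclideanLin ((1 : Matrix n n 𝕜).submatrix id c) x‖ ≤ ‖x‖ := by
  have hadj : Matrix.toEuclideanLin ((1 : Matrix n n 𝕜).submatrix id c) =
      LinearMap.adjoint (Matrix.toEuclideanLin ((1 : Matrix n n 𝕜).submatrix c id)) := by
    rw [← Matrix.toEuclideanLin_conjTranspose_eq_adjoint, Matrix.conjTranspose_submatrix,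
      Matrix.conjTranspose_one]
  have hkey : ‖Matrix.toEuclideanLin ((1 : Matrix n n 𝕜).submatrix id c) x‖ ^ 2 ≤
      ‖x‖ * ‖Matrix.toEuclideanLin ((1 : Matrix n n 𝕜).submatrix id c) x‖ := by
    rw [← inner_self_eq_norm_sq (𝕜 := 𝕜), hadj, LinearMap.adjoint_inner_left]
    exact (re_inner_le_norm _ _).trans (mul_le_mul_of_nonneg_left
      (norm_toEuclideanLin_one_submatrix_le hc _) (norm_nonneg _))
  by_cases h0 : ‖Matrix.toEuclideanLin ((1 : Matrix n n 𝕜).submatrix id c) x‖ = 0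
  · rw [h0]
    exact norm_nonneg _
  · rw [sq] at hkey
    exact le_of_mul_le_mul_right hkey (lt_of_le_of_ne (norm_nonneg _) (Ne.symm h0))

/-- [folklore] `A[r, c] = 1[r, ·] · A · 1[·, c]` as linear maps on Euclidean space. -/
private theorem toEuclideanLin_submatrix_eq_comp {m' n' : Type*} [Fintype m'] [Fintype n']
    [DecidableEq n'] [DecidableEq m] (A : Matrix m n 𝕜) (r : m' → m) (c : n' → n) :
    Matrix.toEuclideanLin (A.submatrix r c) =
      Matrix.toEuclideanLin ((1 : Matrix m m 𝕜).submatrix r id) ∘ₗ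
        (Matrix.toEuclideanLin A ∘ₗ Matrix.toEuclideanLin ((1 : Matrix n n 𝕜).submatrix id c)) := by
  have hmat : A.submatrix r c =
      (1 : Matrix m m 𝕜).submatrix r id * (A * (1 : Matrix n n 𝕜).submatrix id c) := by
    ext i' j'
    simp [Matrix.mul_apply, Matrix.one_apply]
  show Matrix.toLpLin 2 2 (A.submatrix r c) =
    Matrix.toLpLin 2 2 ((1 : Matrix m m 𝕜).submatrix r id) ∘ₗ
      (Matrix.toLpLin 2 2 A ∘ₗ Matrix.toLpLin 2 2 ((1 : Matrix n n 𝕜).submatrix id c))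
  rw [hmat, Matrix.toLpLin_mul_same, Matrix.toLpLin_mul_same]

/-- **Interlacing for submatrices**: deleting rows and columns can only decrease each singular
value, `σ_k(A[r, c]) ≤ σ_k(A)` for injective row/column selections `r`, `c` and every `k`
(the upper half of `σ_k(A) ≥ σ_k(Â) ≥ σ_{k+s}(A)`). [cite: HornJohnson2013, §7.3 Cor 7.3.6 (7.3.7)]
[cite: GolubVanLoan2013, §8.6.2 Cor 8.6.3] -/
theorem singularValues_submatrix_le {m' n' : Type*} [Fintype m'] [Fintype n'] [DecidableEq n']
    (A : Matrix m n 𝕜) {r : m' → m} {c : n' → n} (hr : Function.Injective r)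
    (hc : Function.Injective c) (k : ℕ) :
    (Matrix.toEuclideanLin (A.submatrix r c)).singularValues k ≤
      (Matrix.toEuclideanLin A).singularValues k := by
  classical
  rw [toEuclideanLin_submatrix_eq_comp A r c]
  exact singularValues_comp_le_of_norm_le (Matrix.toEuclideanLin A)
    (Matrix.toEuclideanLin ((1 : Matrix m m 𝕜).submatrix r id))
    (Matrix.toEuclideanLin ((1 : Matrix n n 𝕜).submatrix id c))
    (norm_toEuclideanLin_one_submatrix_le hr) (norm_toEuclideanLin_one_submatrix_id_le hc) k

end MatrixForms

end Literature.LinearAlgebra.Matrix
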